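import Summits.BirchSwinnertonDyer.BirchSwinnertonDyer.Theorems.ResidualThetaTransportAtTwoSignedMuSeedAtTwoPlusTiltCoboundary
import HarnessLib

/-!
# Seed crux `SignedMuSeedAtTwoPlus` (stmt-BirchSwinnertonDyer-21438), line `norm-field-tilt`:
# EXISTENCE of the `D`-logarithmic derivative `S_m` of a series of even order in characteristic `2`

Cell `bsd-wall`, width seat `bsd-wall-rtt-p4-w2` g10; thirteenth file on the line.  The engine theorems
(`oddDigit_of_nonDeg_theta`, `…_zFour`) take the `D log`s `S_m` as data with `Z_m·S_m = η̄·Z_m'`; this file shows the data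
EXISTS and is unique, so `S_m` is a function of `Z_m` (whose order `2^{m+2}` is even).  HONEST FRAMING: THEOREMS ONLY;
closes no item; the line is NOT registered; BSD is NOT proved by this.

* `derivative_X_pow_two_mul_mul` — in characteristic `2`, `(t^{2a}·V)' = t^{2a}·V'`;
* **`exists_logDeriv_of_even_order`** — over a field of characteristic `2`: `Z ≠ 0` of even order ⟹ for every `u` there is
  `S` with `Z·S = u·Z'` (namely `S = u·V'·V⁻¹` for `Z = t^{2a}V`, `V(0) ≠ 0`); with `logDeriv_unique` (p657296) it is unique;
* `existsUnique_logDeriv_of_even_order` — the packaged `∃!`.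
[folklore]
-/

noncomputable section

set_option autoImplicit false
set_option linter.dupNamespace false

open PowerSeries

namespace Summit.BirchSwinnertonDyer.BirchSwinnertonDyer.Theorems.SignedMuAtTwo.Tilt

/-- In characteristic `2`: `(t^{2a}·V)' = t^{2a}·V'`. [folklore] -/
theorem derivative_X_pow_two_mul_mul {k : Type*} [CommRing k] [CharP k 2] (a : ℕ) (V : PowerSeries k) :
    d⁄dX k (X ^ (2 * a) * V) = X ^ (2 * a) * d⁄dX k V := by
  rw [Derivation.leibniz, smul_eq_mul, smul_eq_mul, derivative_pow k, derivative_X, mul_one]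
  have h2 : ((2 * a : ℕ) : PowerSeries k) = 0 := by
    rw [← map_natCast (C (R := k)), Nat.cast_mul, Nat.cast_ofNat, CharTwo.two_eq_zero, zero_mul, map_zero]
  rw [h2, zero_mul, mul_zero, add_zero]

/-- **The `D log` of a series of even order exists** (field of characteristic `2`): `Z ≠ 0`, `ord Z` even ⟹
`∃ S, Z·S = u·Z'`. [folklore] -/
theorem exists_logDeriv_of_even_order {k : Type*} [Field k] [CharP k 2] (u Z : PowerSeries k) (hZ : Z ≠ 0)
    (heven : Even Z.order.toNat) : ∃ S : PowerSeries k, Z * S = u * d⁄dX k Z := by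
  obtain ⟨a, ha⟩ := heven
  have hV0 : constantCoeff Z.divXPowOrder ≠ 0 := by
    rw [Ne, constantCoeff_divXPowOrder_eq_zero_iff]; exact hZ
  have hZeq : Z = X ^ (2 * a) * Z.divXPowOrder := by
    rw [two_mul, ← ha]; exact (X_pow_order_mul_divXPowOrder (f := Z)).symm
  generalize Z.divXPowOrder = V at hV0 hZeq
  subst hZeq
  refine ⟨u * d⁄dX k V * V⁻¹, ?_⟩
  rw [derivative_X_pow_two_mul_mul]
  have hinv : V * V⁻¹ = 1 := PowerSeries.mul_inv_cancel _ hV0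
  calc X ^ (2 * a) * V * (u * d⁄dX k V * V⁻¹)
      = X ^ (2 * a) * u * d⁄dX k V * (V * V⁻¹) := by ring
    _ = u * (X ^ (2 * a) * d⁄dX k V) := by rw [hinv]; ring

/-- **Existence and uniqueness of `D log`** for a series of even order over a field of characteristic `2`. [folklore] -/
theorem existsUnique_logDeriv_of_even_order {k : Type*} [Field k] [CharP k 2] (u Z : PowerSeries k) (hZ : Z ≠ 0)
    (heven : Even Z.order.toNat) : ∃! S : PowerSeries k, Z * S = u * d⁄dX k Z := by
  obtain ⟨S, hS⟩ := exists_logDeriv_of_even_order u Z hZ heven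
  exact ⟨S, hS, fun S' hS' => logDeriv_unique hZ hS' hS⟩

end Summit.BirchSwinnertonDyer.BirchSwinnertonDyer.Theorems.SignedMuAtTwo.Tilt

end
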